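import Summits.QuantumAdvantage.QuantumAdvantage.Theorems.WhiteBoxWalkWbwWitnessGlue
import Summits.QuantumAdvantage.QuantumAdvantage.Theorems.WbwObfuscatedGluedTreesKowFPExtension
import Literature.Computability.Cryptography.ObfuscatedGluedTrees

/-!
# Route `WhiteBoxWalk`, glue item `WbwWitnessGlue` (stmt-QuantumAdvantage-14785) — II: the glue for the LANDED generator

Sequel of `WhiteBoxWalkWbwWitnessGlue.lean` (the generator-parametric glue). The definition
`Literature.Computability.Cryptography.obfuscatedGluedTreesGen Λ` (file
`Literature/Computability/Cryptography/ObfuscatedGluedTrees.lean`, definition item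
`defn-obfuscatedGluedTreesGen-2`, landed 2026-08-16) carries a PARAMETER RECORD `Λ : Params`
(depth, PRF parameter, key length, obfuscator parameter, COIN SCHEDULE, circuit presentation of the
neighbour predicate) and ships the two structural lemmas of the route's plan in the following form:
`FPData.polyTimeComputable_gen : FPData Λ O P → PolyTimeComputable id id (gen Λ O P)` — CONDITIONAL
on the typed `FP` data `FPData Λ O P` — and `exists_poly_length_ans` (unconditional, `p = X`). The
object ignores the injective one-way `f` and the exponent `c` (`obfuscatedGluedTreesGen_fst/_snd`).

Consequently the glue `W → S → WbwEngine` for THIS generator is not pure bookkeeping: at every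
BPR15 §5.1 parameter point `(ε, O, P, f)` supplied by the premise `H` of `WbwEngine` somebody must
EXHIBIT a parameter record `Λ` with `FPData Λ O P` (and whatever admissibility the typed W and S
demand of `Λ`: `CircCorrect`, `ObfPreservesAt`, size bounds, `coinLen = O.coins`, …). This file
states the glue with that obligation explicit:

* `wbwEngine_of_obfuscatedGluedTreesGen` — `∃Λ` form: if every parameter point admits a `Λ` with
  `FPData Λ O P`, clause (Q) and clause (C) for `(gen Λ O P, ans Λ O P)`, then `WbwEngine`.
* `wbwEngine_of_obfuscatedGluedTreesGen_of_admissible` — the THREE-ITEM shape the typed glue should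
  have: `W` (clause (C) for every `Λ` admissible for (C)), `S` (clause (Q) for every `Λ` admissible
  for (Q)) and an EXISTENCE item `E` ("some `Λ` is admissible for both and has `FPData`"), for
  arbitrary admissibility predicates `AdmC`, `AdmQ` (whatever the planner types), imply `WbwEngine`.
* `wbwThesis_of_obfuscatedGluedTreesGen_of_side` — the same under a side condition `Good O` on the
  obfuscator with the premise strengthened by `Good` (typing obligation T8, see part I), concluding
  `WbwThesis`.
* Towards the existence item `E`: `codeFP_obf_of_isEfficient`, `codeFP_prfEval_of_isEfficient` (the
  two PRIMITIVE fields of `FPData` follow from `O.IsEfficient` / `P.IsEfficient` by the route's total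
  `FP` extension of machines on codes, `KnowledgeOfWalk.FPExtension.exists_FP_extension`) and
  `fpData_of_isEfficient` (so `FPData Λ O P` reduces to `CodeFP` of the five schedules of `Λ` and of
  its circuit presentation), assembled in `wbwEngine_of_obfuscatedGluedTreesGen_of_schedules` — the
  most economical typed shape of the glue this file can offer: `W → S → E' → WbwEngine` with `E'` =
  "at every parameter point some `Λ` is admissible for (C) and (Q) and has `CodeFP` schedules and
  presentation".

Recorded for the planner (not used in the proofs): `FPData Λ O P` asks for `CodeFP` (uniform
polynomial time ON CODES) of the schedules `Λ.coinLen` and `Λ.keyPartLen`; for a functionality- and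
security-correct `Λ` these are `O.coins κ N_K` and `P.keyLen μ`, which `O.IsEfficient` /
`P.IsEfficient` only BOUND polynomially (`RandAlg.IsPolyTime`, `IsEfficientFamily`) — so `E` is
dischargeable from `H` only if `H` (the antecedent of `WbwEngine`) also grants a computable coin
schedule of `O` (T8) and a computable key-length schedule of `P` (or `P.keyLen = id`), both free in
print; the fields `FPData.obf` / `FPData.prfEval` do follow from `O.IsEfficient` / `P.IsEfficient`
(`KnowledgeOfWalk.FPExtension.exists_FP_extension`), and `FPData.circ` needs an `FP`-uniform
polynomial-size circuit presentation of `N_K` (machine-to-circuit simulation, `TM2Circuits`).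
-/

namespace Summit.QuantumAdvantage.QuantumAdvantage.Theorems.WhiteBoxWalk

open Literature.Computability.Cryptography Literature.Computability.Complexity
open Literature.Computability.Cryptography.ObfuscatedGluedTrees
open Summit.QuantumAdvantage.QuantumAdvantage.Theorems.WbwObfuscatedGluedTrees.Negative (ClauseC)

/-- **Glue for the landed generator, `∃Λ` form.** If at every BPR15 §5.1 parameter point
(`ε ∈ (0,1)`, `O` a `(2^{κ^ε},2^{-κ^ε})`-secure iO for `P/poly`, `P` a length-preserving
`(2^{κ^ε},2^{-κ^ε})`-secure puncturable PRF, `f` injective one-way) there is a parameter record `Λ`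
with the polynomial-time data `FPData Λ O P`, clause (Q) and clause (C) for the pair
`(gen Λ O P, ans Λ O P)`, then `WbwEngine`: the witness of `WbwThesis` is that pair, `gen ∈ FP` by
`FPData.polyTimeComputable_gen`, the length clause by `exists_poly_length_ans`. [folklore] -/
theorem wbwEngine_of_obfuscatedGluedTreesGen
    (h : ∀ ε : ℝ, 0 < ε → ε < 1 → ∀ O : CircuitObfuscator, IsSubexpIO ε ppolyCircuits O →
      ∀ P : PuncturablePRFScheme, P.inLen = id → P.outLen = id →
        IsTDSecurePuncturablePRF P (fun κ => (2 : ℝ) ^ ((κ : ℝ) ^ ε))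
          (fun κ => (2 : ℝ) ^ (-((κ : ℝ) ^ ε))) →
      ∀ f : List Bool → List Bool, IsOneWay f → Function.Injective f →
      ∃ Λ : Params, FPData Λ O P ∧
        (∃ F : QCircuitFamily cliffordT, F.IsOracleFree ∧ F.IsUniform ∧
          ∀ s, 2 / 3 ≤ F.kernelProb 0 (gen Λ O P s) {y | ans Λ O P s <+: y}) ∧
        ClauseC (gen Λ O P) (ans Λ O P)) :
    Theses.WhiteBoxWalk.WbwEngine := by
  unfold Theses.WhiteBoxWalk.WbwEngine
  rintro ⟨ε, hε, hε1, ⟨O, hO⟩, ⟨P, hPin, hPout, hP⟩, f, hf, hinj⟩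
  obtain ⟨Λ, hFP, hQ, hC⟩ := h ε hε hε1 O hO P hPin hPout hP f hf hinj
  exact ⟨gen Λ O P, ans Λ O P, hFP.polyTimeComputable_gen, exists_poly_length_ans Λ O P, hQ, hC⟩

/-- **Glue for the landed generator, three-item shape.** For ANY admissibility predicates
`AdmC`, `AdmQ` on parameter records at a parameter point: if clause (C) holds for every
`Λ` admissible for (C) (the typed crux `W = WbwObfuscatedGluedTrees`), clause (Q) holds for every
`Λ` admissible for (Q) (the typed support `S = WbwSuccinctWalk`), and at every parameter point SOME
`Λ` is admissible for both and carries `FPData Λ O P` (an existence item `E`), then `WbwEngine`.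
This is the shape `W → S → E → WbwEngine` the glue item should be typed in. [folklore] -/
theorem wbwEngine_of_obfuscatedGluedTreesGen_of_admissible
    (AdmC AdmQ : ℝ → CircuitObfuscator → PuncturablePRFScheme → (List Bool → List Bool) → Params → Prop)
    (hW : ∀ ε : ℝ, 0 < ε → ε < 1 → ∀ O : CircuitObfuscator, IsSubexpIO ε ppolyCircuits O →
      ∀ P : PuncturablePRFScheme, P.inLen = id → P.outLen = id →
        IsTDSecurePuncturablePRF P (fun κ => (2 : ℝ) ^ ((κ : ℝ) ^ ε))
          (fun κ => (2 : ℝ) ^ (-((κ : ℝ) ^ ε))) →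
      ∀ f : List Bool → List Bool, IsOneWay f → Function.Injective f →
      ∀ Λ : Params, AdmC ε O P f Λ → ClauseC (gen Λ O P) (ans Λ O P))
    (hS : ∀ ε : ℝ, 0 < ε → ε < 1 → ∀ O : CircuitObfuscator, IsSubexpIO ε ppolyCircuits O →
      ∀ P : PuncturablePRFScheme, P.inLen = id → P.outLen = id →
        IsTDSecurePuncturablePRF P (fun κ => (2 : ℝ) ^ ((κ : ℝ) ^ ε))
          (fun κ => (2 : ℝ) ^ (-((κ : ℝ) ^ ε))) →
      ∀ f : List Bool → List Bool, IsOneWay f → Function.Injective f →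
      ∀ Λ : Params, AdmQ ε O P f Λ →
        ∃ F : QCircuitFamily cliffordT, F.IsOracleFree ∧ F.IsUniform ∧
          ∀ s, 2 / 3 ≤ F.kernelProb 0 (gen Λ O P s) {y | ans Λ O P s <+: y})
    (hE : ∀ ε : ℝ, 0 < ε → ε < 1 → ∀ O : CircuitObfuscator, IsSubexpIO ε ppolyCircuits O →
      ∀ P : PuncturablePRFScheme, P.inLen = id → P.outLen = id →
        IsTDSecurePuncturablePRF P (fun κ => (2 : ℝ) ^ ((κ : ℝ) ^ ε))
          (fun κ => (2 : ℝ) ^ (-((κ : ℝ) ^ ε))) →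
      ∀ f : List Bool → List Bool, IsOneWay f → Function.Injective f →
      ∃ Λ : Params, AdmC ε O P f Λ ∧ AdmQ ε O P f Λ ∧ FPData Λ O P) :
    Theses.WhiteBoxWalk.WbwEngine :=
  wbwEngine_of_obfuscatedGluedTreesGen fun ε hε hε1 O hO P hPin hPout hP f hf hinj => by
    obtain ⟨Λ, hAC, hAQ, hFP⟩ := hE ε hε hε1 O hO P hPin hPout hP f hf hinj
    exact ⟨Λ, hFP, hS ε hε hε1 O hO P hPin hPout hP f hf hinj Λ hAQ,
      hW ε hε hε1 O hO P hPin hPout hP f hf hinj Λ hAC⟩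

/-- **Glue for the landed generator under a side condition on the obfuscator** (T8 form of part I,
`∃Λ` version): with the obligations stated only for obfuscators satisfying `Good`, the premise
STRENGTHENED by `Good` implies `WbwThesis`. [folklore] -/
theorem wbwThesis_of_obfuscatedGluedTreesGen_of_side (Good : CircuitObfuscator → Prop)
    (h : ∀ ε : ℝ, 0 < ε → ε < 1 → ∀ O : CircuitObfuscator, IsSubexpIO ε ppolyCircuits O → Good O →
      ∀ P : PuncturablePRFScheme, P.inLen = id → P.outLen = id →
        IsTDSecurePuncturablePRF P (fun κ => (2 : ℝ) ^ ((κ : ℝ) ^ ε))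
          (fun κ => (2 : ℝ) ^ (-((κ : ℝ) ^ ε))) →
      ∀ f : List Bool → List Bool, IsOneWay f → Function.Injective f →
      ∃ Λ : Params, FPData Λ O P ∧
        (∃ F : QCircuitFamily cliffordT, F.IsOracleFree ∧ F.IsUniform ∧
          ∀ s, 2 / 3 ≤ F.kernelProb 0 (gen Λ O P s) {y | ans Λ O P s <+: y}) ∧
        ClauseC (gen Λ O P) (ans Λ O P))
    (hH : ∃ ε : ℝ, 0 < ε ∧ ε < 1 ∧ (∃ O : CircuitObfuscator, IsSubexpIO ε ppolyCircuits O ∧ Good O) ∧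
      TDSecurePuncturablePRFExist (fun κ => (2 : ℝ) ^ ((κ : ℝ) ^ ε))
        (fun κ => (2 : ℝ) ^ (-((κ : ℝ) ^ ε))) id id ∧
      ∃ f : List Bool → List Bool, IsOneWay f ∧ Function.Injective f) :
    Theses.WhiteBoxWalk.WbwThesis := by
  obtain ⟨ε, hε, hε1, ⟨O, hO, hG⟩, ⟨P, hPin, hPout, hP⟩, f, hf, hinj⟩ := hH
  obtain ⟨Λ, hFP, hQ, hC⟩ := h ε hε hε1 O hO hG P hPin hPout hP f hf hinj
  exact ⟨gen Λ O P, ans Λ O P, hFP.polyTimeComputable_gen, exists_poly_length_ans Λ O P, hQ, hC⟩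

/-! ## Towards the existence item: the primitive fields of `FPData` from efficiency -/

/-- The obfuscator's run map on codes `⟨⟨1^κ, code C⟩, r⟩ ↦ code of O(κ, C; r)` is `CodeFP` as soon
as `O` is efficient (`O.IsEfficient` is `PolyTimeComputable` of exactly this map on exactly these
codes; a total `FP` extension exists by the clocked universal simulation). [folklore] -/
theorem codeFP_obf_of_isEfficient {O : CircuitObfuscator} (hO : O.IsEfficient) :
    CodeFP (CodeFP.pairE (CodeFP.pairE CodeFP.unE encodeSizedCircuit) CodeFP.strE) encodeSizedCircuit
      (fun p : (ℕ × SizedCircuit) × List Bool => (⟨p.1.2.1, O.obf p.1.1 p.1.2.2 p.2⟩ : SizedCircuit)) := by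
  obtain ⟨F, hF, h⟩ := WbwObfuscatedGluedTrees.KnowledgeOfWalk.FPExtension.exists_FP_extension hO.1
  exact ⟨F, hF, fun p => h p⟩

/-- The PRF evaluation map on codes `⟨1^μ, ⟨k, x⟩⟩ ↦ PRF_k(x)` is `CodeFP` as soon as `P` is
efficient (`P.IsEfficient` contains `IsEfficientFamily P.eval …`, whose first conjunct is
`PolyTimeComputable` of this map on these codes). [folklore] -/
theorem codeFP_prfEval_of_isEfficient {P : PuncturablePRFScheme} (hP : P.IsEfficient) :
    CodeFP (CodeFP.pairE CodeFP.unE (CodeFP.pairE CodeFP.strE CodeFP.strE)) CodeFP.strE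
      (fun p : ℕ × List Bool × List Bool => P.eval p.1 p.2.1 p.2.2) := by
  obtain ⟨F, hF, h⟩ := WbwObfuscatedGluedTrees.KnowledgeOfWalk.FPExtension.exists_FP_extension hP.1.1
  exact ⟨F, hF, fun p => h p⟩

/-- **`FPData` from efficiency of the primitives.** For efficient `O` and `P`, the polynomial-time
data of the generator reduce to the route's own choices: `CodeFP` (in unary) of the five schedules of
`Λ` and `CodeFP` of its circuit presentation on `⟨1ⁿ, K⟩`. (What remains is exactly where typing
obligation T8 lives: a functionality-correct coin schedule is `O.coins κ N_K`, a security-correct key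
length is `P.keyLen μ`, and neither is computable from `O.IsEfficient` / `P.IsEfficient` alone.)
[folklore] -/
theorem fpData_of_isEfficient {Λ : Params} {O : CircuitObfuscator} {P : PuncturablePRFScheme}
    (hO : O.IsEfficient) (hP : P.IsEfficient)
    (hdepth : CodeFP CodeFP.unE CodeFP.unE Λ.depth) (hprf : CodeFP CodeFP.unE CodeFP.unE Λ.prfParam)
    (hkey : CodeFP CodeFP.unE CodeFP.unE Λ.keyPartLen) (hsec : CodeFP CodeFP.unE CodeFP.unE Λ.secParam)
    (hcoin : CodeFP CodeFP.unE CodeFP.unE Λ.coinLen)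
    (hcirc : CodeFP (CodeFP.pairE CodeFP.unE CodeFP.strE) encodeSizedCircuit
      (fun p : ℕ × List Bool => (⟨_, Λ.circ p.1 p.2⟩ : SizedCircuit))) :
    FPData Λ O P :=
  ⟨hdepth, hprf, hkey, hsec, hcoin, hcirc, codeFP_prfEval_of_isEfficient hP, codeFP_obf_of_isEfficient hO⟩

/-- **Glue for the landed generator, schedules form** (the three-item shape with the existence item
reduced by `fpData_of_isEfficient`): the efficiency of `O` and `P` comes from the premise
(`IsSecureIO.isEfficient`, `IsPuncturablePRFNonuniform`), so the existence item only has to exhibit,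
at every parameter point, a record `Λ` admissible for (C) and for (Q) whose five schedules are
`CodeFP` in unary and whose circuit presentation is `CodeFP` on `⟨1ⁿ, K⟩`. [folklore] -/
theorem wbwEngine_of_obfuscatedGluedTreesGen_of_schedules
    (AdmC AdmQ : ℝ → CircuitObfuscator → PuncturablePRFScheme → (List Bool → List Bool) → Params → Prop)
    (hW : ∀ ε : ℝ, 0 < ε → ε < 1 → ∀ O : CircuitObfuscator, IsSubexpIO ε ppolyCircuits O →
      ∀ P : PuncturablePRFScheme, P.inLen = id → P.outLen = id →
        IsTDSecurePuncturablePRF P (fun κ => (2 : ℝ) ^ ((κ : ℝ) ^ ε))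
          (fun κ => (2 : ℝ) ^ (-((κ : ℝ) ^ ε))) →
      ∀ f : List Bool → List Bool, IsOneWay f → Function.Injective f →
      ∀ Λ : Params, AdmC ε O P f Λ → ClauseC (gen Λ O P) (ans Λ O P))
    (hS : ∀ ε : ℝ, 0 < ε → ε < 1 → ∀ O : CircuitObfuscator, IsSubexpIO ε ppolyCircuits O →
      ∀ P : PuncturablePRFScheme, P.inLen = id → P.outLen = id →
        IsTDSecurePuncturablePRF P (fun κ => (2 : ℝ) ^ ((κ : ℝ) ^ ε))
          (fun κ => (2 : ℝ) ^ (-((κ : ℝ) ^ ε))) →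
      ∀ f : List Bool → List Bool, IsOneWay f → Function.Injective f →
      ∀ Λ : Params, AdmQ ε O P f Λ →
        ∃ F : QCircuitFamily cliffordT, F.IsOracleFree ∧ F.IsUniform ∧
          ∀ s, 2 / 3 ≤ F.kernelProb 0 (gen Λ O P s) {y | ans Λ O P s <+: y})
    (hE : ∀ ε : ℝ, 0 < ε → ε < 1 → ∀ O : CircuitObfuscator, IsSubexpIO ε ppolyCircuits O →
      ∀ P : PuncturablePRFScheme, P.inLen = id → P.outLen = id →
        IsTDSecurePuncturablePRF P (fun κ => (2 : ℝ) ^ ((κ : ℝ) ^ ε))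
          (fun κ => (2 : ℝ) ^ (-((κ : ℝ) ^ ε))) →
      ∀ f : List Bool → List Bool, IsOneWay f → Function.Injective f →
      ∃ Λ : Params, AdmC ε O P f Λ ∧ AdmQ ε O P f Λ ∧
        CodeFP CodeFP.unE CodeFP.unE Λ.depth ∧ CodeFP CodeFP.unE CodeFP.unE Λ.prfParam ∧
        CodeFP CodeFP.unE CodeFP.unE Λ.keyPartLen ∧ CodeFP CodeFP.unE CodeFP.unE Λ.secParam ∧
        CodeFP CodeFP.unE CodeFP.unE Λ.coinLen ∧
        CodeFP (CodeFP.pairE CodeFP.unE CodeFP.strE) encodeSizedCircuit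
          (fun p : ℕ × List Bool => (⟨_, Λ.circ p.1 p.2⟩ : SizedCircuit))) :
    Theses.WhiteBoxWalk.WbwEngine :=
  wbwEngine_of_obfuscatedGluedTreesGen_of_admissible AdmC AdmQ hW hS
    fun ε hε hε1 O hO P hPin hPout hP f hf hinj => by
      obtain ⟨Λ, hAC, hAQ, h1, h2, h3, h4, h5, h6⟩ := hE ε hε hε1 O hO P hPin hPout hP f hf hinj
      exact ⟨Λ, hAC, hAQ, fpData_of_isEfficient hO.isEfficient hP.isPuncturablePRFNonuniform.1
        h1 h2 h3 h4 h5 h6⟩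

end Summit.QuantumAdvantage.QuantumAdvantage.Theorems.WhiteBoxWalk
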